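import Summits.MatrixMultiplication.OmegaCensus.DicyclicN1Law
import HarnessLib

/-!
# Class N1 for odd-part quotients, part 1: the `±` lemma and the dichotomy with supplied killing characters

ω-census `pub-omega`, family (b3), seat pub-omega-group gen 13.  Framing: lottery ticket; floor = certified bounds/negative
ranges.  VALUE: kernel lemmas for the TPP capacity of dihedral-like groups; NOT progress on ω.

Gen 12's N1 chain (`DicyclicN1Chars` → `DicyclicN1Dichotomy` → `DicyclicN1Cosets` → `DicyclicN1Law`) uses the `2`-group
hypothesis `2^m · B = 0` on `B = A/⟨c₀⟩` at exactly one place: to produce, in `eq_or_eq_neg_of_two_point`, a character `χ`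
of `B` with `χ ι = 1` and `χ(π e₁) = −1` for the two survivors `ι = π e₁ ∓ π e₀`.  Here that character is a HYPOTHESIS
(`hkill`); the proofs are otherwise gen 12's, verbatim.  When `A/⟨c₀⟩` has an odd part the character is supplied by a real
character `(−1)^{ω∘Ψ}` through `Ψ = (ψ₁,ψ₂,ψ₃) : A → 𝔽₂³` (`DicyclicN1General.lean`).

* `eq_or_eq_neg_of_two_point'`, `n1_dichotomy'`.
-/

namespace Summit.MatrixMultiplication.OmegaCensus

open Finset

section TwoPoint

variable {B : Type} [AddCommGroup B] [Fintype B] [DecidableEq B]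

/-- **The `±` lemma, with the killing characters as a hypothesis** (gen 12's `eq_or_eq_neg_of_two_point` has
`2^m · B = 0` and produces them from `exists_addChar_eq_one_eq_neg_one`). `P ≠ P'`, `f₀ ≠ 0 ≠ f₁`; suppose that for every character `χ` of `B`
`(χ P + χ P')·(1 − χ(f₁ − f₀))·(1 − χ(f₁ + f₀)) = 0`, and that `χ f₁ = −1` forces `χ P + χ P' = 0`.  Then `f₁ = f₀` or
`f₁ = −f₀`. [folklore] -/
theorem eq_or_eq_neg_of_two_point' {P P' f₀ f₁ : B} (hPP : P ≠ P')
    (hkill : ∀ ι : B, (ι = f₁ - f₀ ∨ ι = f₁ + f₀) → ι + ι = 0 → f₁ ≠ ι → ∃ χ : AddChar B ℂ, χ ι = 1 ∧ χ f₁ = -1)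
    (hf₀ : f₀ ≠ 0)
    (hinv : ∀ χ : AddChar B ℂ, (χ P + χ P') * ((1 - χ (f₁ - f₀)) * (1 - χ (f₁ + f₀))) = 0)
    (hpar : ∀ χ : AddChar B ℂ, χ f₁ = -1 → χ P + χ P' = 0) : f₁ = f₀ ∨ f₁ = -f₀ := by
  by_contra hcon
  obtain ⟨hne₁, hne₂⟩ := not_or.1 hcon
  set U := f₁ - f₀ with hU
  set V := f₁ + f₀ with hV
  have hU0 : U ≠ 0 := fun h => hne₁ (sub_eq_zero.1 h)
  have hV0 : V ≠ 0 := fun h => hne₂ (eq_neg_of_add_eq_zero_left h)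
  have I1 := two_point_inversion hinv P
  have I2 := two_point_inversion hinv P'
  have nPU : ¬ (P + U = P) := fun h => hU0 (add_left_cancel (h.trans (add_zero P).symm))
  have nPV : ¬ (P + V = P) := fun h => hV0 (add_left_cancel (h.trans (add_zero P).symm))
  have nP'U : ¬ (P' + U = P') := fun h => hU0 (add_left_cancel (h.trans (add_zero P').symm))
  have nP'V : ¬ (P' + V = P') := fun h => hV0 (add_left_cancel (h.trans (add_zero P').symm))
  have hP'P : ¬ (P' = P) := fun h => hPP h.symm
  rw [if_pos rfl, if_neg nPU, if_neg nPV, if_neg hP'P] at I1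
  rw [if_neg hPP, if_pos rfl, if_neg nP'U, if_neg nP'V] at I2
  -- the surviving configurations
  have key : (P' = P + U ∧ U + U = 0) ∨ (P' = P + V ∧ V + V = 0) := by
    by_cases hUV : U + V = 0
    · -- then both `P' + U = P` and `P' + V = P`
      have e1 : P + U + V = P := by rw [add_assoc, hUV, add_zero]
      have e2 : P' + U + V = P' := by rw [add_assoc, hUV, add_zero]
      have n2 : ¬ (P' + U + V = P) := by rw [e2]; exact hP'P
      rw [if_pos e1, if_neg n2] at I1
      have h1 : P' + U = P := by by_contra h; rw [if_neg h] at I1; split_ifs at I1 <;> omega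
      have h2 : P' + V = P := by by_contra h; rw [if_neg h] at I1; omega
      have hUV' : U = V := add_left_cancel (h1.trans h2.symm)
      have h2U : U + U = 0 := by nth_rewrite 2 [hUV']; exact hUV
      left
      refine ⟨?_, h2U⟩
      calc P' = P' + U + U := by rw [add_assoc, h2U, add_zero]
        _ = P + U := by rw [h1]
    · have n1 : ¬ (P + U + V = P) := fun h => hUV (add_left_cancel ((add_assoc P U V).symm.trans
        (h.trans (add_zero P).symm)))
      have n2 : ¬ (P' + U + V = P') := fun h => hUV (add_left_cancel ((add_assoc P' U V).symm.trans
        (h.trans (add_zero P').symm)))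
      rw [if_neg n1] at I1
      rw [if_neg n2] at I2
      -- from `I1`: exactly one of `P' + U = P`, `P' + V = P`; from `I2`: one of `P + U = P'`, `P + V = P'`
      by_cases a1 : P' + U = P
      · have nb1 : ¬ (P' + V = P) := by
          intro h
          rw [if_pos a1, if_pos h] at I1
          have h3 : P' + U + V = P := by by_contra h3; rw [if_neg h3] at I1; omega
          rw [a1] at h3
          exact nPV h3
        by_cases a2 : P + U = P'
        · left
          refine ⟨a2.symm, ?_⟩
          have : P + (U + U) = P := by rw [← add_assoc, a2, a1]
          exact add_left_cancel (this.trans (add_zero P).symm)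
        · have b2 : P + V = P' := by
            by_contra h; rw [if_neg a2, if_neg h] at I2; split_ifs at I2 <;> omega
          exfalso; apply hUV
          have : P' + (U + V) = P' := by rw [← add_assoc, a1, b2]
          exact add_left_cancel (this.trans (add_zero P').symm)
      · have b1 : P' + V = P := by
          by_contra h; rw [if_neg a1, if_neg h] at I1; split_ifs at I1 <;> omega
        by_cases a2 : P + U = P'
        · exfalso; apply hUV
          have : P' + (V + U) = P' := by rw [← add_assoc, b1, a2]
          rw [add_comm V U] at this
          exact add_left_cancel (this.trans (add_zero P').symm)
        · have b2 : P + V = P' := by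
            by_contra h; rw [if_neg a2, if_neg h] at I2; split_ifs at I2 <;> omega
          right
          refine ⟨b2.symm, ?_⟩
          have : P + (V + V) = P := by rw [← add_assoc, b2, b1]
          exact add_left_cancel (this.trans (add_zero P).symm)
  -- kill both configurations with a character `χ(f₁ ∓ f₀) = 1`, `χ f₁ = −1`
  rcases key with ⟨hr, h2⟩ | ⟨hr, h2⟩
  · have hx : f₁ ≠ U := by
      intro h; apply hf₀
      have : f₁ - f₀ = f₁ - 0 := by rw [sub_zero]; exact h.symm
      exact sub_right_injective this
    obtain ⟨χ, hχU, hχ1⟩ := hkill U (Or.inl hU) h2 hx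
    have h0 := hpar χ hχ1
    rw [hr, AddChar.map_add_eq_mul, hχU, mul_one, ← two_mul] at h0
    exact addChar_apply_ne_zero χ P ((mul_eq_zero.1 h0).resolve_left two_ne_zero)
  · have hx : f₁ ≠ V := by
      intro h; apply hf₀
      have : f₁ + f₀ = f₁ + 0 := by rw [add_zero]; exact h.symm
      exact add_left_cancel this
    obtain ⟨χ, hχV, hχ1⟩ := hkill V (Or.inr hV) h2 hx
    have h0 := hpar χ hχ1
    rw [hr, AddChar.map_add_eq_mul, hχV, mul_one, ← two_mul] at h0
    exact addChar_apply_ne_zero χ P ((mul_eq_zero.1 h0).resolve_left two_ne_zero)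


end TwoPoint

section N1Dichotomy

variable {A : Type} [AddCommGroup A] [Fintype A] [DecidableEq A] {B : Type} [AddCommGroup B] [Fintype B]
  [DecidableEq B]

/-- **The two `T`-differences agree up to sign modulo `c₀`** — gen 12's `n1_dichotomy` with the `2`-group hypothesis
replaced by the killing characters for `π e₁` (hypothesis `hkill`).
[folklore] -/
theorem n1_dichotomy' (π : A →+ B) (hπ : Function.Surjective π) {c₀ : A}
    (hker : ∀ a : A, π a = 0 ↔ a = 0 ∨ a = c₀) (hc₀ : c₀ ≠ 0)
    {U₀ U₁ : Finset A} {e₀ e₁ α₁ α₂ α₃ β₁ β₂ β₃ y : A}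
    (hU₀e₀ : Disjoint U₀ (U₀.image (· + e₀))) (hU₀e₁ : Disjoint U₀ (U₀.image (· + e₁)))
    (hU₁e₀ : Disjoint U₁ (U₁.image (· + e₀))) (hU₁e₁ : Disjoint U₁ (U₁.image (· + e₁)))
    (hcard : U₀.card = U₁.card + 2) (hA : Fintype.card A = 4 * U₀.card + 2 * U₁.card)
    (h12 : Disjoint (U₀.image (· + α₁) ∪ U₀.image (· + (α₁ + e₀))) (U₁.image (· + α₂) ∪ U₁.image (· + (α₂ + e₀))))
    (h13 : Disjoint (U₀.image (· + α₁) ∪ U₀.image (· + (α₁ + e₀))) (U₀.image (· + α₃) ∪ U₀.image (· + (α₃ + e₁))))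
    (h23 : Disjoint (U₁.image (· + α₂) ∪ U₁.image (· + (α₂ + e₀))) (U₀.image (· + α₃) ∪ U₀.image (· + (α₃ + e₁))))
    (k12 : Disjoint (U₀.image (· + β₁) ∪ U₀.image (· + (β₁ + e₁))) (U₁.image (· + β₂) ∪ U₁.image (· + (β₂ + e₁))))
    (k13 : Disjoint (U₀.image (· + β₁) ∪ U₀.image (· + (β₁ + e₁))) (U₀.image (· + β₃) ∪ U₀.image (· + (β₃ + e₀))))
    (k23 : Disjoint (U₁.image (· + β₂) ∪ U₁.image (· + (β₂ + e₁))) (U₀.image (· + β₃) ∪ U₀.image (· + (β₃ + e₀))))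
    (hrel₁ : β₁ - β₂ = α₁ - α₂) (hrel₂ : β₃ - β₂ = α₃ - α₂ + e₁ - e₀ + c₀)
    (hper₀ : (U₀ ∪ U₀.image (· + e₁)).image (· + c₀) = U₀ ∪ U₀.image (· + e₁))
    (hper₁ : (U₁ ∪ U₁.image (· + e₁)).image (· + c₀) = U₁ ∪ U₁.image (· + e₁))
    (hsub : U₁.image (· + y) ∪ U₁.image (· + (y + e₁)) ⊆ U₀ ∪ U₀.image (· + e₁))
    (hkill : ∀ ι : B, (ι = π e₁ - π e₀ ∨ ι = π e₁ + π e₀) → ι + ι = 0 → π e₁ ≠ ι →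
      ∃ χ : AddChar B ℂ, χ ι = 1 ∧ χ (π e₁) = -1) :
    π e₀ = 0 ∨ π e₁ = 0 ∨ π e₁ = π e₀ ∨ π e₁ = -π e₀ := by
  by_cases he₀ : π e₀ = 0
  · exact Or.inl he₀
  by_cases he₁ : π e₁ = 0
  · exact Or.inr (Or.inl he₁)
  right; right
  have hπc : π c₀ = 0 := (hker c₀).2 (Or.inr rfl)
  have h2c : c₀ + c₀ = 0 := by
    rcases (hker (c₀ + c₀)).1 (by rw [map_add, hπc, add_zero]) with h | h
    · exact h
    · exact absurd (add_eq_left.1 h) hc₀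
  -- the uncovered set `E`
  set D := U₀ ∪ U₀.image (· + e₁) with hD
  set C := U₁.image (· + y) ∪ U₁.image (· + (y + e₁)) with hC
  set E := D \ C with hE
  have dD : Disjoint U₀ (U₀.image (· + e₁)) := hU₀e₁
  have dC : Disjoint (U₁.image (· + y)) (U₁.image (· + (y + e₁))) := disjoint_shift hU₁e₁ y
  have cE : E.card = 4 := by
    rw [hE, card_sdiff_of_subset hsub, hD, card_pair_union dD, hC, card_two_translates dC]; omega
  have hCper : C.image (· + c₀) = C := by
    have e : C = (U₁ ∪ U₁.image (· + e₁)).image (· + y) := by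
      rw [hC, image_union, image_add_image, add_comm e₁ y]
    rw [e, image_add_image, add_comm y c₀, ← image_add_image, hper₁]
  have hEper : E.image (· + c₀) = E := by
    apply eq_of_subset_of_card_le _ (by rw [card_image_of_injective _ (add_left_injective c₀)])
    intro x hx
    obtain ⟨z, hz, rfl⟩ := mem_image.1 hx
    obtain ⟨hzD, hzC⟩ := mem_sdiff.1 hz
    refine mem_sdiff.2 ⟨by rw [← hper₀]; exact mem_image_of_mem _ hzD, fun h => hzC ?_⟩
    have : z + c₀ + c₀ ∈ C := by rw [← hCper]; exact mem_image_of_mem _ h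
    rwa [add_assoc, h2c, add_zero] at this
  obtain ⟨p, p', hpE, hp'E, hp'p, hp'pc, hEeq, hEdisj⟩ := periodic_card_four hc₀ h2c hEper cE
  have hne₁ : p ≠ p + c₀ := fun h => hc₀ (left_eq_add.1 h)
  have hne₂ : p' ≠ p' + c₀ := fun h => hc₀ (left_eq_add.1 h)
  -- the character sum over `E`
  have key : ∀ χ : AddChar B ℂ, 2 * (χ (π p) + χ (π p')) =
      (1 + χ.compAddMonoidHom π e₁) *
        ((∑ x ∈ U₀, χ.compAddMonoidHom π x) - χ.compAddMonoidHom π y * ∑ x ∈ U₁, χ.compAddMonoidHom π x) := by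
    intro χ
    set ψ := χ.compAddMonoidHom π with hψdef
    have hψc : ψ c₀ = 1 := by rw [hψdef, AddChar.compAddMonoidHom_apply, hπc, AddChar.map_zero_eq_one]
    have S0 : (∑ x ∈ E, ψ x) + ∑ x ∈ C, ψ x = ∑ x ∈ D, ψ x := sum_sdiff hsub
    rw [hEeq, sum_union hEdisj, sum_pair hne₁, sum_pair hne₂, hC, charsum_two_translates ψ dC, hD,
      charsum_pair_union ψ dD, AddChar.map_add_eq_mul, AddChar.map_add_eq_mul, hψc,
      AddChar.map_add_eq_mul] at S0
    have e1 : χ (π p) = ψ p := by rw [hψdef, AddChar.compAddMonoidHom_apply]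
    have e2 : χ (π p') = ψ p' := by rw [hψdef, AddChar.compAddMonoidHom_apply]
    rw [e1, e2]
    linear_combination S0
  -- hypotheses of the `±` lemma
  have hPP : π p ≠ π p' := by
    intro h
    rcases (hker (p' - p)).1 (by rw [map_sub, h, sub_self]) with h' | h'
    · exact hp'p (sub_eq_zero.1 h')
    · exact hp'pc (by rw [← h', add_sub_cancel])
  have hinv : ∀ χ : AddChar B ℂ, (χ (π p) + χ (π p')) * ((1 - χ (π e₁ - π e₀)) * (1 - χ (π e₁ + π e₀))) = 0 := by
    intro χ
    obtain ⟨HY, HQ⟩ := n1_charsum_vanish π hπ hπc hU₀e₀ hU₀e₁ hU₁e₀ hU₁e₁ hA h12 h13 h23 k12 k13 k23 hrel₁ hrel₂ χ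
    have eu : χ (π e₁ - π e₀) = χ.compAddMonoidHom π (e₁ - e₀) := by
      rw [AddChar.compAddMonoidHom_apply, map_sub π]
    have ev : χ (π e₁ + π e₀) = χ.compAddMonoidHom π (e₁ + e₀) := by
      rw [AddChar.compAddMonoidHom_apply, map_add π]
    rw [eu, ev]
    have h2 : (2 : ℂ) ≠ 0 := two_ne_zero
    have := key χ
    have h3 : 2 * ((χ (π p) + χ (π p')) * ((1 - χ.compAddMonoidHom π (e₁ - e₀)) *
        (1 - χ.compAddMonoidHom π (e₁ + e₀)))) = 0 := by
      rw [← mul_assoc, this]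
      linear_combination (1 + χ.compAddMonoidHom π e₁) * HY
        - (1 + χ.compAddMonoidHom π e₁) * χ.compAddMonoidHom π y * HQ
    exact (mul_eq_zero.1 h3).resolve_left h2
  have hpar : ∀ χ : AddChar B ℂ, χ (π e₁) = -1 → χ (π p) + χ (π p') = 0 := by
    intro χ hχ
    have := key χ
    rw [AddChar.compAddMonoidHom_apply, hχ, add_neg_cancel, zero_mul] at this
    exact (mul_eq_zero.1 this).resolve_left two_ne_zero
  rcases eq_or_eq_neg_of_two_point' hPP hkill he₀ hinv hpar with h | h
  · exact Or.inl h
  · exact Or.inr h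


end N1Dichotomy

end Summit.MatrixMultiplication.OmegaCensus
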